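import Summits.QuantumFields.YangMills.Theorems.BalabanUVNodesK0Stub3RunwiseFace

/-!
# K0⁷ V19 — STUB 3ᴬ′: THE β OF RECORD AT A1's WITNESS IS BLIND TO THE CUBE LETTER `(j, c)` AND TO [15]'s CONSTANTS OTHER THAN `a₀` (kernel, `rfl`);
# hence the (j, c)-GENERIC socket ⟺ its (j, c, ε₀, B₃, B₃′, a₁)-UNIFORM core — ONE two-parameter family `β₁₃(F; a₀, ε₂₉)` per torus family

Cell `pub-ymgap`, width seat `pub-ymgap-k0-s3-w2` (g0; director-ym R399 (3a) ∕ №207 «(j,c)-generic sub-faces of `stub_absBetaBoxAtThm1WitnessCCMGen13` by CLAIM»; bus LOCATED-1 +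
CLAIM-2 I.29540).  `--kind proof --supports stmt-QuantumFields-20541 --as helper` (count-neutral).  NEW leaf; theorems only; 0 `def`; nothing modified; no registry write.  Companion of
`…K0Stub3RunwiseFace` (p607023 ✓; the run-wise face 3ᴿ), imported for §4's run-core composition.  [15] = [Balaban1985Variational]; [6] = [Balaban1985RegularSpaces]; [I] = [Balaban1987RG1]; [II] = [Balaban1989LargeFieldII];
[III] = [Balaban1988Convergent].

THE KERNEL FACT (§1, `rfl`).  `betaOfRecord₁₃ F N θ = betaOfMerged (betaMerged F (mergedTermFamilyMatT F N (TcanOfRecord F N) (chiFixed29 F N θ.ν θ.ε₂₉) θ.εbg) θ.ρ8 θ.bV)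
(beta0OfMerged … θ.v₀) θ.γ` ([I] (1.20)–(1.22) on the merged term (1.6), the (2.9) species at threshold `ε₂₉`); the (2.9) characteristic function `chiFixed29` reads the Stage-7
numerics ONLY through the background minimiser `Uk F N K (k+1) ν.εreg W` of `critCfgOfRecord` ([I] (2.3) p.265), i.e. through [15] Thm 1's regularity threshold `ν.εreg`; and at
A1's collared witness `θ₁₅ᶜᶜᴹ(j; ε₀, ε₂₉; B₃, B₃′, a₀, a₁) = theta13OfThm1CCM F N j ε₀ ε₂₉ B₃ B₃' a₀ a₁` one has `ν.εreg = a₀` while `j` (cube letter `M₁ = τ9.M = L^j`), `ε₀`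
(`ν.ε₀`), `B₃, B₃′, a₁` (inside `ν.A₀ = A₀ᶜᶜ¹`) sit in fields the β-layer never reads, and `εbg, ρ8, bV, v₀, γ = ½` are the family's.  Hence, BY `rfl`,
`β₁₃(θ₁₅ᶜᶜᴹ(j; ε₀, ε₂₉; B₃, B₃′, a₀, a₁)) = β₁₃(θ₁₅ᶜᶜᴹ(j′; ε₀′, ε₂₉; C₃, C₃′, a₀, c₁))` for all letters, `= β₁₃(θ₁₅ᶜᶜ¹(ε₀, ε₂₉; B₃, B₃′, a₀, a₁))` (dag-n26-c's C¹ witness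
`theta13OfThm1CC1`): the β-functions of record at the K0 witness are ONE two-parameter family `β₁₃(F; a₀, ε₂₉)`.  (Varying `a₀` or `ε₂₉` is NOT definitional.)

CONSEQUENCE (§2–§4).  V19's registered socket `K0V19Defs.AbsBetaBoxAtThm1WitnessCCMGenAt F` quantifies `∀ j c B₃ B₃′ a₀ a₁` (under the tokens (8) ∕ (9) at `(L^j, c)`) and lets the
window `γ₀`, the thresholds `ε₀, ε₂₉` and the bound `β′` depend on all of them; by §1 it is EQUIVALENT (★ `absBetaBoxGenAt_iff_uniform`) to its UNIFORM core «for every regularity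
threshold `a₀ > 0` at which [15] Thm 1's (8)-sentence and some floor-carrying (9)-token are inhabited (at any cube letter and constants), SOME `γ₀, ε₂₉ > 0` and `β′` box
`β₁₃(θ₁₅ᶜᶜᴹ(j; ε₀, ε₂₉; B₃, B₃′, a₀, a₁))` on `]0, γ₀]` SIMULTANEOUSLY for all `j, ε₀, B₃, B₃′, a₁`» — (j,c)-genericity is FREE; the same for the run-wise face 3ᴿ of
`…K0Stub3RunwiseFace` (★ `run3R_iff_uniform`, over DEF-1's `RunConstRemainder … (fun _ => 0) β′ γ₀`).  So a NODE O supplier owes ONE bound per `(a₀, ε₂₉)` — at `θ₁₅ᶜᶜ¹` if it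
prefers (`absBetaBoxGenAt_of_boxAtCC1`): every «at θ₁₅ᶜᶜ¹ ∕ θ₁₅ᶜᶜᴹ(3) ∕ θ₁₅ᶜᶜᴹ(j)» β-box or run-letter in the tree is the SAME statement.  §4 composes K0⁷ BY NAME from stub 1's
text + ONE of: the uniform box core ∕ the token-free box core ∕ a box at the C¹ witness ∕ the uniform RUN core ∕ a run letter at the C¹ witness (stub 2′ discharged by
name, p595104; the run road through `K0Stub3RunwiseFace.record13SepCoPHInhabited_of_stub1_run3R_byName`, p607023).

HONEST FRAMING.  A typing fact about the tree's definitions (which letters the β-layer reads) and iff repackagings of the registered text; NO β estimate; nothing of Bałaban asserted;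
3ᴬ′ ∕ 3ᴿ remain NODE O's wall ([I] §1 p.264 «uniformly bounded» STATED, proof unpublished [II] p.355); no stub proved; K0⁷ stmt-QuantumFields-20541 OPEN (stubs 1 ∧ 3ᴬ′ active);
V19 87879403b3a26109 STANDS; counts unmoved (typed 28∕28 · discharged 5∕28) — count words are the chair's.  One finite 𝕋⁴ programme at fixed `ε = L^{−K}`, Bałaban AS PRINTED — NOT
continuum ∕ ℝ⁴ ∕ OS ∕ mass gap ∕ Clay: the Yang–Mills mass gap is NOT proved by any of this; route R4 closes the CONDITIONAL finite-𝕋⁴ rung `BalabanLadder.UV` only.  No `sorry`,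
`def`, `instance`, `notation`, `axiom`.
-/

noncomputable section

open scoped Matrix.Norms.L2Operator

namespace Summit.QuantumFields.YangMills.Theorems.K0Stub3CubeLetterBlind

open Literature.MathematicalPhysics.QuantumFieldTheory.Balaban1983to89
open Literature.MathematicalPhysics.QuantumFieldTheory.Balaban1983to89.Node00
open Literature.MathematicalPhysics.QuantumFieldTheory.Balaban1983to89.T4Continuum
open Literature.MathematicalPhysics.QuantumFieldTheory.Balaban1983to89.FlowStep
open Summit.QuantumFields.YangMills.Theorems.BalabanUVNodesK2NamedJetsRunRemAt (RunConstRemainder)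
open Summit.QuantumFields.YangMills.Theorems.K0V19Defs (Prop8StepCoPAt Prop6MemberB8AtP AbsBetaBoxAtThm1WitnessCCMGenAt record13SepCoPHInhabited_of_stubTexts)
open Summit.QuantumFields.YangMills.Theorems.K0V19Stub2Prime (stub_prop6MemberB8AtP13 record13SepCoPHInhabited_of_stub1_stub3A'_byName)
open Summit.QuantumFields.YangMills.Theorems.K0Stub3RunwiseFace (record13SepCoPHInhabited_of_stub1_run3R_byName)

/-! ## §1  The kernel fact: the β of record at A1's witness reads only `(a₀, ε₂₉)` -/

section Blind

variable (F : T4Family) (N : ℕ) [NeZero N]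

/-- **★ THE β OF RECORD AT A1's COLLARED WITNESS IS BLIND TO THE CUBE LETTER `j`, TO `ε₀`, AND TO `B₃, B₃′, a₁`** (`rfl`): the β-layer ([I] (1.20)–(1.22) on the merged term (1.6)
with the (2.9) species) reads the Stage-7 numerics only through `ν.εreg = a₀` (the background minimiser of (2.3)), never `M₁ = L^j`, `ν.ε₀`, `ν.A₀`.
[cite: Balaban1987RG1, (1.20)–(1.22) p.264, (1.6) p.261, (2.3) p.265, (2.9) p.266; Balaban1985Variational, Thm 1 p.279 (the threshold `a₀`)] -/
theorem betaOfRecord₁₃_theta13OfThm1CCM_letterBlind (j j' : ℕ) (ε₀ ε₀' ε₂₉ B₃ C₃ B₃' C₃' a₀ a₁ c₁ : ℝ) :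
    betaOfRecord₁₃ F N (theta13OfThm1CCM F N j ε₀ ε₂₉ B₃ B₃' a₀ a₁) = betaOfRecord₁₃ F N (theta13OfThm1CCM F N j' ε₀' ε₂₉ C₃ C₃' a₀ c₁) := rfl

/-- **… AND IT IS THE β OF dag-n26-c's C¹ WITNESS `θ₁₅ᶜᶜ¹`** (`rfl`): the collar `M₁ : (44+3L)·L ↦ L^j` touched only `ν.M₁` and `τ9.M`.
[cite: Balaban1987RG1, (1.20)–(1.22) p.264, (2.9) p.266; Balaban1985RegularSpaces, (1.3)–(1.6) p.77 (bookkeeping)] -/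
theorem betaOfRecord₁₃_theta13OfThm1CCM_eq_CC1 (j : ℕ) (ε₀ ε₂₉ B₃ B₃' a₀ a₁ : ℝ) :
    betaOfRecord₁₃ F N (theta13OfThm1CCM F N j ε₀ ε₂₉ B₃ B₃' a₀ a₁) = betaOfRecord₁₃ F N (theta13OfThm1CC1 F N ε₀ ε₂₉ B₃ B₃' a₀ a₁) := rfl

/-- The C¹ witness's β is likewise blind to `ε₀, B₃, B₃′, a₁` (`rfl`). [cite: Balaban1987RG1, (1.20)–(1.22) p.264, (2.9) p.266 (bookkeeping)] -/
theorem betaOfRecord₁₃_theta13OfThm1CC1_letterBlind (ε₀ ε₀' ε₂₉ B₃ C₃ B₃' C₃' a₀ a₁ c₁ : ℝ) :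
    betaOfRecord₁₃ F N (theta13OfThm1CC1 F N ε₀ ε₂₉ B₃ B₃' a₀ a₁) = betaOfRecord₁₃ F N (theta13OfThm1CC1 F N ε₀' ε₂₉ C₃ C₃' a₀ c₁) := rfl

/-- Hence the GENERATED RUNS of the witness are letter-blind too (`gOfRecord₁₃ θ p = genSeq β₁₃(θ) g₀(p)`; `rfl`). [cite: Balaban1987RG1, (0.17)–(0.20) pp.255–256 (bookkeeping)] -/
theorem gOfRecord₁₃_theta13OfThm1CCM_letterBlind (j j' : ℕ) (ε₀ ε₀' ε₂₉ B₃ C₃ B₃' C₃' a₀ a₁ c₁ : ℝ) :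
    gOfRecord₁₃ F N (theta13OfThm1CCM F N j ε₀ ε₂₉ B₃ B₃' a₀ a₁) = gOfRecord₁₃ F N (theta13OfThm1CCM F N j' ε₀' ε₂₉ C₃ C₃' a₀ c₁) := rfl

end Blind

/-! ## §2  ★ The registered socket 3ᴬ′ ⟺ its (j, c, ε₀, B₃, B₃′, a₁)-UNIFORM core -/

section BoxFace

variable (F : T4Family)

/-- **★ (j,c)-GENERICITY IS FREE: 3ᴬ′ ⟺ ITS UNIFORM CORE.**  V19's `AbsBetaBoxAtThm1WitnessCCMGenAt F` holds iff for every regularity threshold `a₀ > 0` AT WHICH [15] Thm 1's (8)-sentence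
and some floor-carrying (9)-token are inhabited (at any cube letter `c ≤ L^j` and constants `2L² ≤ B₃`, `0 < B₃′`, `0 < a₁`), some window `γ₀ > 0`, (2.9) threshold `ε₂₉ > 0` and bound
`β′` give the sign-free box `−β′ ≤ β₁₃ ≤ β′` on `]0, γ₀]` for `β₁₃ = betaOfRecord₁₃ F 2 (theta13OfThm1CCM F 2 j ε₀ ε₂₉ B₃ B₃' a₀ a₁)` SIMULTANEOUSLY FOR ALL `j, ε₀, B₃, B₃′, a₁` (§1: these
are one function).  (→: instantiate at the inhabited letter, transport by `rfl`; ←: `ε₀ := 1`.)  A repackaging of the registered text; nothing asserted.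
[cite: Balaban1987RG1, Thm 1 p.259, §1 (1.20)–(1.22) p.264, (2.9) p.266; Balaban1985Variational, Thm 1 (8)–(9) p.279; Balaban1989LargeFieldII, p.355] -/
theorem absBetaBoxGenAt_iff_uniform :
    AbsBetaBoxAtThm1WitnessCCMGenAt F ↔
      ∀ a₀ : ℝ, 0 < a₀ →
        (∃ (j c : ℕ) (B₃ B₃' a₁ : ℝ), c ≤ F.L ^ j ∧ 2 * (F.L : ℝ) ^ 2 ≤ B₃ ∧ 0 < B₃' ∧ 0 < a₁ ∧
          VariationalThm1RegSepCoP7M F 2 B₃ a₀ a₁ ∧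
          Gauge9RegSepTopStepR F 2 (fun ν K Ω => suppDomOfRecord F ν K Ω) (F.L ^ j) c B₃ B₃' a₀ a₁) →
        ∃ γ₀ ε₂₉ β' : ℝ, 0 < γ₀ ∧ 0 < ε₂₉ ∧ ∀ (j : ℕ) (ε₀ B₃ B₃' a₁ : ℝ),
          BetaLowerH (-β') γ₀ (betaOfRecord₁₃ F 2 (theta13OfThm1CCM F 2 j ε₀ ε₂₉ B₃ B₃' a₀ a₁)) ∧
          BetaUpperH β' γ₀ (betaOfRecord₁₃ F 2 (theta13OfThm1CCM F 2 j ε₀ ε₂₉ B₃ B₃' a₀ a₁)) := by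
  constructor
  · rintro h a₀ ha₀ ⟨j, c, B₃, B₃', a₁, hc, hB₃, hB₃', ha₁, h15, h9⟩
    obtain ⟨γ₀, ε₀, ε₂₉, β', hγ₀, -, hε', hlow, hup⟩ := h j c B₃ B₃' a₀ a₁ hc hB₃ hB₃' ha₀ ha₁ h15 h9
    refine ⟨γ₀, ε₂₉, β', hγ₀, hε', fun j' ε₀' C₃ C₃' c₁ => ?_⟩
    rw [betaOfRecord₁₃_theta13OfThm1CCM_letterBlind F 2 j' j ε₀' ε₀ ε₂₉ C₃ B₃ C₃' B₃' a₀ c₁ a₁]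
    exact ⟨hlow, hup⟩
  · intro h j c B₃ B₃' a₀ a₁ hc hB₃ hB₃' ha₀ ha₁ h15 h9
    obtain ⟨γ₀, ε₂₉, β', hγ₀, hε', hall⟩ := h a₀ ha₀ ⟨j, c, B₃, B₃', a₁, hc, hB₃, hB₃', ha₁, h15, h9⟩
    exact ⟨γ₀, 1, ε₂₉, β', hγ₀, one_pos, hε', (hall j 1 B₃ B₃' a₁).1, (hall j 1 B₃ B₃' a₁).2⟩

/-- **A TOKEN-FREE SUFFICIENT CORE**: a sign-free box of the family `β₁₃(F; a₀, ε₂₉)` for EVERY `a₀ > 0` at SOME `ε₂₉ > 0` (read at any one representative letter, here all at once by §1)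
pays 3ᴬ′ at `F` — the (8)∕(9) tokens only RESTRICT the `a₀` at which the box is owed.  CONDITIONAL; nothing asserted. [cite: Balaban1987RG1, Thm 1 p.259, §1 p.264; Balaban1989LargeFieldII, p.355] -/
theorem absBetaBoxGenAt_of_tokenFree
    (h : ∀ a₀ : ℝ, 0 < a₀ → ∃ γ₀ ε₂₉ β' : ℝ, 0 < γ₀ ∧ 0 < ε₂₉ ∧ ∀ (j : ℕ) (ε₀ B₃ B₃' a₁ : ℝ),
      BetaLowerH (-β') γ₀ (betaOfRecord₁₃ F 2 (theta13OfThm1CCM F 2 j ε₀ ε₂₉ B₃ B₃' a₀ a₁)) ∧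
      BetaUpperH β' γ₀ (betaOfRecord₁₃ F 2 (theta13OfThm1CCM F 2 j ε₀ ε₂₉ B₃ B₃' a₀ a₁))) :
    AbsBetaBoxAtThm1WitnessCCMGenAt F :=
  (absBetaBoxGenAt_iff_uniform F).mpr fun a₀ ha₀ _ => h a₀ ha₀

/-- **THE C¹-WITNESS FILES FEED THE GENERIC SOCKET VERBATIM**: a sign-free box of `β₁₃(θ₁₅ᶜᶜ¹(ε₀, ε₂₉; B₃, B₃′, a₀, a₁))` on some window, for every admissible `a₀` at ANY ONE member
`(ε₀, B₃, B₃′, a₁)` of dag-n26-c's C¹ family with that `a₀` (e.g. node00-def-K0a FILE 14d's box on `]0, ½]` at `θ₁₅ᶜᶜ¹`, an4's `betaBox_half_theta13OfThm1CC1_of_drift_atSlopeCont`), pays 3ᴬ′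
at EVERY cube letter (§1 `…_eq_CC1`).  CONDITIONAL; nothing asserted. [cite: Balaban1987RG1, Thm 1 p.259, §1 (1.20)–(1.22) p.264; Balaban1988RG2Cluster, Lemma 3 (2.38) p.20; Balaban1989LargeFieldII, p.355] -/
theorem absBetaBoxGenAt_of_boxAtCC1
    (h : ∀ a₀ : ℝ, 0 < a₀ →
      (∃ (j c : ℕ) (B₃ B₃' a₁ : ℝ), c ≤ F.L ^ j ∧ 2 * (F.L : ℝ) ^ 2 ≤ B₃ ∧ 0 < B₃' ∧ 0 < a₁ ∧
        VariationalThm1RegSepCoP7M F 2 B₃ a₀ a₁ ∧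
        Gauge9RegSepTopStepR F 2 (fun ν K Ω => suppDomOfRecord F ν K Ω) (F.L ^ j) c B₃ B₃' a₀ a₁) →
      ∃ (ε₀ B₃ B₃' a₁ γ₀ ε₂₉ β' : ℝ), 0 < γ₀ ∧ 0 < ε₂₉ ∧
        BetaLowerH (-β') γ₀ (betaOfRecord₁₃ F 2 (theta13OfThm1CC1 F 2 ε₀ ε₂₉ B₃ B₃' a₀ a₁)) ∧
        BetaUpperH β' γ₀ (betaOfRecord₁₃ F 2 (theta13OfThm1CC1 F 2 ε₀ ε₂₉ B₃ B₃' a₀ a₁))) :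
    AbsBetaBoxAtThm1WitnessCCMGenAt F := by
  refine (absBetaBoxGenAt_iff_uniform F).mpr fun a₀ ha₀ htok => ?_
  obtain ⟨ε₀, B₃, B₃', a₁, γ₀, ε₂₉, β', hγ₀, hε', hlow, hup⟩ := h a₀ ha₀ htok
  refine ⟨γ₀, ε₂₉, β', hγ₀, hε', fun j' ε₀' C₃ C₃' c₁ => ?_⟩
  rw [betaOfRecord₁₃_theta13OfThm1CCM_eq_CC1, betaOfRecord₁₃_theta13OfThm1CC1_letterBlind F 2 ε₀' ε₀ ε₂₉ C₃ B₃ C₃' B₃' a₀ c₁ a₁]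
  exact ⟨hlow, hup⟩

end BoxFace

/-! ## §3  ★ The run-wise face 3ᴿ (`…K0Stub3RunwiseFace`) ⟺ its UNIFORM core -/

section RunFace

variable (F : T4Family)

/-- **★ 3ᴿ ⟺ ITS UNIFORM CORE** — the run-wise face of 3ᴬ′ (ym-nodeO P3 g51 W-R3A shape over DEF-1's tree letter `RunConstRemainder β (fun _ => 0) β′ γ₀` = «`|β_{k+1}(g_0,…,g_k)| ≤ β′` along
every solution of (0.20) up to `n` staying in `]0, γ₀]`», [I] Thm 3 p.264) holds iff for every admissible `a₀` SOME `γ₀, ε₂₉ > 0`, `β′` give the run letter for ALL `j, ε₀, B₃, B₃′, a₁` at once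
(§1: one function, hence one set of runs).  A repackaging; nothing asserted. [cite: Balaban1987RG1, Thm 1 p.259, Thm 3 p.264, (1.20)–(1.22) p.264, (2.9) p.266; Balaban1985Variational, Thm 1 (8)–(9) p.279] -/
theorem run3R_iff_uniform :
    (∀ (j c : ℕ) (B₃ B₃' a₀ a₁ : ℝ), c ≤ F.L ^ j → 2 * (F.L : ℝ) ^ 2 ≤ B₃ → 0 < B₃' → 0 < a₀ → 0 < a₁ →
      VariationalThm1RegSepCoP7M F 2 B₃ a₀ a₁ →
      Gauge9RegSepTopStepR F 2 (fun ν K Ω => suppDomOfRecord F ν K Ω) (F.L ^ j) c B₃ B₃' a₀ a₁ →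
      ∃ γ₀ ε₀ ε₂₉ β' : ℝ, 0 < γ₀ ∧ 0 < ε₀ ∧ 0 < ε₂₉ ∧
        RunConstRemainder (betaOfRecord₁₃ F 2 (theta13OfThm1CCM F 2 j ε₀ ε₂₉ B₃ B₃' a₀ a₁)) (fun _ => 0) β' γ₀) ↔
      ∀ a₀ : ℝ, 0 < a₀ →
        (∃ (j c : ℕ) (B₃ B₃' a₁ : ℝ), c ≤ F.L ^ j ∧ 2 * (F.L : ℝ) ^ 2 ≤ B₃ ∧ 0 < B₃' ∧ 0 < a₁ ∧
          VariationalThm1RegSepCoP7M F 2 B₃ a₀ a₁ ∧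
          Gauge9RegSepTopStepR F 2 (fun ν K Ω => suppDomOfRecord F ν K Ω) (F.L ^ j) c B₃ B₃' a₀ a₁) →
        ∃ γ₀ ε₂₉ β' : ℝ, 0 < γ₀ ∧ 0 < ε₂₉ ∧ ∀ (j : ℕ) (ε₀ B₃ B₃' a₁ : ℝ),
          RunConstRemainder (betaOfRecord₁₃ F 2 (theta13OfThm1CCM F 2 j ε₀ ε₂₉ B₃ B₃' a₀ a₁)) (fun _ => 0) β' γ₀ := by
  constructor
  · rintro h a₀ ha₀ ⟨j, c, B₃, B₃', a₁, hc, hB₃, hB₃', ha₁, h15, h9⟩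
    obtain ⟨γ₀, ε₀, ε₂₉, β', hγ₀, -, hε', hR⟩ := h j c B₃ B₃' a₀ a₁ hc hB₃ hB₃' ha₀ ha₁ h15 h9
    refine ⟨γ₀, ε₂₉, β', hγ₀, hε', fun j' ε₀' C₃ C₃' c₁ => ?_⟩
    rw [betaOfRecord₁₃_theta13OfThm1CCM_letterBlind F 2 j' j ε₀' ε₀ ε₂₉ C₃ B₃ C₃' B₃' a₀ c₁ a₁]
    exact hR
  · intro h j c B₃ B₃' a₀ a₁ hc hB₃ hB₃' ha₀ ha₁ h15 h9
    obtain ⟨γ₀, ε₂₉, β', hγ₀, hε', hall⟩ := h a₀ ha₀ ⟨j, c, B₃, B₃', a₁, hc, hB₃, hB₃', ha₁, h15, h9⟩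
    exact ⟨γ₀, 1, ε₂₉, β', hγ₀, one_pos, hε', hall j 1 B₃ B₃' a₁⟩

/-- **A TOKEN-FREE SUFFICIENT CORE FOR 3ᴿ**: the run letter of the family `β₁₃(F; a₀, ε₂₉)` for every `a₀ > 0` at some `ε₂₉ > 0` pays 3ᴿ at `F`.  CONDITIONAL; nothing asserted.
[cite: Balaban1987RG1, Thm 1 p.259, Thm 3 p.264; Balaban1989LargeFieldII, p.355] -/
theorem run3R_of_tokenFree
    (h : ∀ a₀ : ℝ, 0 < a₀ → ∃ γ₀ ε₂₉ β' : ℝ, 0 < γ₀ ∧ 0 < ε₂₉ ∧ ∀ (j : ℕ) (ε₀ B₃ B₃' a₁ : ℝ),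
      RunConstRemainder (betaOfRecord₁₃ F 2 (theta13OfThm1CCM F 2 j ε₀ ε₂₉ B₃ B₃' a₀ a₁)) (fun _ => 0) β' γ₀) :
    ∀ (j c : ℕ) (B₃ B₃' a₀ a₁ : ℝ), c ≤ F.L ^ j → 2 * (F.L : ℝ) ^ 2 ≤ B₃ → 0 < B₃' → 0 < a₀ → 0 < a₁ →
      VariationalThm1RegSepCoP7M F 2 B₃ a₀ a₁ →
      Gauge9RegSepTopStepR F 2 (fun ν K Ω => suppDomOfRecord F ν K Ω) (F.L ^ j) c B₃ B₃' a₀ a₁ →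
      ∃ γ₀ ε₀ ε₂₉ β' : ℝ, 0 < γ₀ ∧ 0 < ε₀ ∧ 0 < ε₂₉ ∧
        RunConstRemainder (betaOfRecord₁₃ F 2 (theta13OfThm1CCM F 2 j ε₀ ε₂₉ B₃ B₃' a₀ a₁)) (fun _ => 0) β' γ₀ :=
  (run3R_iff_uniform F).mpr fun a₀ ha₀ _ => h a₀ ha₀

/-- **A RUN LETTER AT THE C¹ WITNESS PAYS 3ᴿ AT EVERY CUBE LETTER** (one representative `(ε₀, B₃, B₃′, a₁)` per admissible `a₀`; §1 `…_eq_CC1`).  CONDITIONAL; nothing asserted.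
[cite: Balaban1987RG1, Thm 1 p.259, Thm 3 p.264, (1.20)–(1.22) p.264; Balaban1989LargeFieldII, p.355] -/
theorem run3R_of_runAtCC1
    (h : ∀ a₀ : ℝ, 0 < a₀ →
      (∃ (j c : ℕ) (B₃ B₃' a₁ : ℝ), c ≤ F.L ^ j ∧ 2 * (F.L : ℝ) ^ 2 ≤ B₃ ∧ 0 < B₃' ∧ 0 < a₁ ∧
        VariationalThm1RegSepCoP7M F 2 B₃ a₀ a₁ ∧
        Gauge9RegSepTopStepR F 2 (fun ν K Ω => suppDomOfRecord F ν K Ω) (F.L ^ j) c B₃ B₃' a₀ a₁) →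
      ∃ (ε₀ B₃ B₃' a₁ γ₀ ε₂₉ β' : ℝ), 0 < γ₀ ∧ 0 < ε₂₉ ∧
        RunConstRemainder (betaOfRecord₁₃ F 2 (theta13OfThm1CC1 F 2 ε₀ ε₂₉ B₃ B₃' a₀ a₁)) (fun _ => 0) β' γ₀) :
    ∀ (j c : ℕ) (B₃ B₃' a₀ a₁ : ℝ), c ≤ F.L ^ j → 2 * (F.L : ℝ) ^ 2 ≤ B₃ → 0 < B₃' → 0 < a₀ → 0 < a₁ →
      VariationalThm1RegSepCoP7M F 2 B₃ a₀ a₁ →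
      Gauge9RegSepTopStepR F 2 (fun ν K Ω => suppDomOfRecord F ν K Ω) (F.L ^ j) c B₃ B₃' a₀ a₁ →
      ∃ γ₀ ε₀ ε₂₉ β' : ℝ, 0 < γ₀ ∧ 0 < ε₀ ∧ 0 < ε₂₉ ∧
        RunConstRemainder (betaOfRecord₁₃ F 2 (theta13OfThm1CCM F 2 j ε₀ ε₂₉ B₃ B₃' a₀ a₁)) (fun _ => 0) β' γ₀ := by
  refine (run3R_iff_uniform F).mpr fun a₀ ha₀ htok => ?_
  obtain ⟨ε₀, B₃, B₃', a₁, γ₀, ε₂₉, β', hγ₀, hε', hR⟩ := h a₀ ha₀ htok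
  refine ⟨γ₀, ε₂₉, β', hγ₀, hε', fun j' ε₀' C₃ C₃' c₁ => ?_⟩
  rw [betaOfRecord₁₃_theta13OfThm1CCM_eq_CC1, betaOfRecord₁₃_theta13OfThm1CC1_letterBlind F 2 ε₀' ε₀ ε₂₉ C₃ B₃ C₃' B₃' a₀ c₁ a₁]
  exact hR

end RunFace

/-! ## §4  K0⁷ BY NAME from stub 1's text and ONE of the cores (stub 2′ by name, p595104; run road p607023) -/

section Stubs

/-- **★★ K0⁷ BY NAME FROM THE TEXTS OF STUBS 1, 2′ AND THE UNIFORM BOX CORE** (`K0V19Defs.record13SepCoPHInhabited_of_stubTexts` = PART 2's composition, fed through §2's iff).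
CONDITIONAL on the three texts (none proved here); K0⁷ OPEN. [cite: Balaban1985Variational, Thm 1 (8)–(9) p.279, Prop. 8 p.304; Balaban1985RegularSpaces, Prop. 6 p.99; Balaban1988Convergent, Thm 1 p.262; Balaban1987RG1, Thm 1 p.259, §1 p.264] -/
theorem record13SepCoPHInhabited_of_stub1_stub2P_uniformCore (h1 : ∀ F : T4Family, Prop8StepCoPAt F) (h2P : ∀ F : T4Family, Prop6MemberB8AtP F)
    (hU : ∀ (F : T4Family) (a₀ : ℝ), 0 < a₀ →
      (∃ (j c : ℕ) (B₃ B₃' a₁ : ℝ), c ≤ F.L ^ j ∧ 2 * (F.L : ℝ) ^ 2 ≤ B₃ ∧ 0 < B₃' ∧ 0 < a₁ ∧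
        VariationalThm1RegSepCoP7M F 2 B₃ a₀ a₁ ∧
        Gauge9RegSepTopStepR F 2 (fun ν K Ω => suppDomOfRecord F ν K Ω) (F.L ^ j) c B₃ B₃' a₀ a₁) →
      ∃ γ₀ ε₂₉ β' : ℝ, 0 < γ₀ ∧ 0 < ε₂₉ ∧ ∀ (j : ℕ) (ε₀ B₃ B₃' a₁ : ℝ),
        BetaLowerH (-β') γ₀ (betaOfRecord₁₃ F 2 (theta13OfThm1CCM F 2 j ε₀ ε₂₉ B₃ B₃' a₀ a₁)) ∧
        BetaUpperH β' γ₀ (betaOfRecord₁₃ F 2 (theta13OfThm1CCM F 2 j ε₀ ε₂₉ B₃ B₃' a₀ a₁))) :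
    Summit.QuantumFields.YangMills.Theses.BalabanUVNodes.Record13SepCoPHInhabited :=
  record13SepCoPHInhabited_of_stubTexts h1 h2P fun F => (absBetaBoxGenAt_iff_uniform F).mpr (hU F)

/-- **★★★ K0⁷ BY NAME FROM STUB 1's TEXT AND THE UNIFORM BOX CORE ALONE** (stub 2′ discharged by name, `K0V19Stub2Prime.stub_prop6MemberB8AtP13` p595104): on this road the open K0⁷ bill
reads {stub 1 ([15] Prop. 8's top step), ONE sign-free box of the two-parameter family `β₁₃(F; a₀, ε₂₉)` per admissible `a₀` (NODE O)}.  CONDITIONAL — displayed, NOT inhabited here; K0⁷ OPEN.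
[cite: Balaban1985Variational, Thm 1 (8)–(9) p.279, Prop. 8 p.304; Balaban1985RegularSpaces, Prop. 6 p.99; Balaban1988Convergent, Thm 1 p.262; Balaban1987RG1, Thm 1 p.259, §1 p.264; Balaban1989LargeFieldII, p.355] -/
theorem record13SepCoPHInhabited_of_stub1_uniformCore_byName (h1 : ∀ F : T4Family, Prop8StepCoPAt F)
    (hU : ∀ (F : T4Family) (a₀ : ℝ), 0 < a₀ →
      (∃ (j c : ℕ) (B₃ B₃' a₁ : ℝ), c ≤ F.L ^ j ∧ 2 * (F.L : ℝ) ^ 2 ≤ B₃ ∧ 0 < B₃' ∧ 0 < a₁ ∧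
        VariationalThm1RegSepCoP7M F 2 B₃ a₀ a₁ ∧
        Gauge9RegSepTopStepR F 2 (fun ν K Ω => suppDomOfRecord F ν K Ω) (F.L ^ j) c B₃ B₃' a₀ a₁) →
      ∃ γ₀ ε₂₉ β' : ℝ, 0 < γ₀ ∧ 0 < ε₂₉ ∧ ∀ (j : ℕ) (ε₀ B₃ B₃' a₁ : ℝ),
        BetaLowerH (-β') γ₀ (betaOfRecord₁₃ F 2 (theta13OfThm1CCM F 2 j ε₀ ε₂₉ B₃ B₃' a₀ a₁)) ∧
        BetaUpperH β' γ₀ (betaOfRecord₁₃ F 2 (theta13OfThm1CCM F 2 j ε₀ ε₂₉ B₃ B₃' a₀ a₁))) :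
    Summit.QuantumFields.YangMills.Theses.BalabanUVNodes.Record13SepCoPHInhabited :=
  record13SepCoPHInhabited_of_stub1_stub2P_uniformCore h1 stub_prop6MemberB8AtP13 hU

/-- **K0⁷ BY NAME FROM STUB 1's TEXT AND THE TOKEN-FREE BOX CORE** (a box of `β₁₃(F; a₀, ε₂₉)` for EVERY `a₀ > 0`).  CONDITIONAL; K0⁷ OPEN.
[cite: Balaban1985Variational, Thm 1 p.279, Prop. 8 p.304; Balaban1988Convergent, Thm 1 p.262; Balaban1987RG1, Thm 1 p.259, §1 p.264; Balaban1989LargeFieldII, p.355] -/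
theorem record13SepCoPHInhabited_of_stub1_tokenFreeCore_byName (h1 : ∀ F : T4Family, Prop8StepCoPAt F)
    (hT : ∀ (F : T4Family) (a₀ : ℝ), 0 < a₀ → ∃ γ₀ ε₂₉ β' : ℝ, 0 < γ₀ ∧ 0 < ε₂₉ ∧ ∀ (j : ℕ) (ε₀ B₃ B₃' a₁ : ℝ),
      BetaLowerH (-β') γ₀ (betaOfRecord₁₃ F 2 (theta13OfThm1CCM F 2 j ε₀ ε₂₉ B₃ B₃' a₀ a₁)) ∧
      BetaUpperH β' γ₀ (betaOfRecord₁₃ F 2 (theta13OfThm1CCM F 2 j ε₀ ε₂₉ B₃ B₃' a₀ a₁))) :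
    Summit.QuantumFields.YangMills.Theses.BalabanUVNodes.Record13SepCoPHInhabited :=
  record13SepCoPHInhabited_of_stub1_stub3A'_byName h1 fun F => absBetaBoxGenAt_of_tokenFree F (hT F)

/-- **K0⁷ BY NAME FROM STUB 1's TEXT AND A BOX AT THE C¹ WITNESS PER ADMISSIBLE `a₀`** (dag-n26-c ∕ an4 ∕ K0a FILE 14d currency at `θ₁₅ᶜᶜ¹`).  CONDITIONAL; K0⁷ OPEN.
[cite: Balaban1985Variational, Thm 1 p.279, Prop. 8 p.304; Balaban1988Convergent, Thm 1 p.262; Balaban1987RG1, Thm 1 p.259, §1 p.264; Balaban1988RG2Cluster, Lemma 3 (2.38) p.20] -/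
theorem record13SepCoPHInhabited_of_stub1_boxAtCC1_byName (h1 : ∀ F : T4Family, Prop8StepCoPAt F)
    (hC : ∀ (F : T4Family) (a₀ : ℝ), 0 < a₀ →
      (∃ (j c : ℕ) (B₃ B₃' a₁ : ℝ), c ≤ F.L ^ j ∧ 2 * (F.L : ℝ) ^ 2 ≤ B₃ ∧ 0 < B₃' ∧ 0 < a₁ ∧
        VariationalThm1RegSepCoP7M F 2 B₃ a₀ a₁ ∧
        Gauge9RegSepTopStepR F 2 (fun ν K Ω => suppDomOfRecord F ν K Ω) (F.L ^ j) c B₃ B₃' a₀ a₁) →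
      ∃ (ε₀ B₃ B₃' a₁ γ₀ ε₂₉ β' : ℝ), 0 < γ₀ ∧ 0 < ε₂₉ ∧
        BetaLowerH (-β') γ₀ (betaOfRecord₁₃ F 2 (theta13OfThm1CC1 F 2 ε₀ ε₂₉ B₃ B₃' a₀ a₁)) ∧
        BetaUpperH β' γ₀ (betaOfRecord₁₃ F 2 (theta13OfThm1CC1 F 2 ε₀ ε₂₉ B₃ B₃' a₀ a₁))) :
    Summit.QuantumFields.YangMills.Theses.BalabanUVNodes.Record13SepCoPHInhabited :=
  record13SepCoPHInhabited_of_stub1_stub3A'_byName h1 fun F => absBetaBoxGenAt_of_boxAtCC1 F (hC F)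

/-- **★★★ K0⁷ BY NAME FROM STUB 1's TEXT AND THE UNIFORM RUN CORE** (the BN-F-robust road: §3 ∘ `K0Stub3RunwiseFace.record13SepCoPHInhabited_of_stub1_run3R_byName`, p607023): the open
K0⁷ bill on this road = {stub 1, ONE run letter `RunConstRemainder β₁₃(F; a₀, ε₂₉) 0 β′ γ₀` per admissible `a₀` (NODE O)}.  CONDITIONAL — displayed, NOT inhabited; K0⁷ OPEN.
[cite: Balaban1985Variational, Thm 1 (8)–(9) p.279, Prop. 8 p.304; Balaban1988Convergent, Thm 1 p.262, (2.6)–(2.8) pp.255–256; Balaban1987RG1, Thm 1 p.259, Thm 3 p.264; Balaban1989LargeFieldII, p.355] -/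
theorem record13SepCoPHInhabited_of_stub1_uniformRunCore_byName (h1 : ∀ F : T4Family, Prop8StepCoPAt F)
    (hU : ∀ (F : T4Family) (a₀ : ℝ), 0 < a₀ →
      (∃ (j c : ℕ) (B₃ B₃' a₁ : ℝ), c ≤ F.L ^ j ∧ 2 * (F.L : ℝ) ^ 2 ≤ B₃ ∧ 0 < B₃' ∧ 0 < a₁ ∧
        VariationalThm1RegSepCoP7M F 2 B₃ a₀ a₁ ∧
        Gauge9RegSepTopStepR F 2 (fun ν K Ω => suppDomOfRecord F ν K Ω) (F.L ^ j) c B₃ B₃' a₀ a₁) →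
      ∃ γ₀ ε₂₉ β' : ℝ, 0 < γ₀ ∧ 0 < ε₂₉ ∧ ∀ (j : ℕ) (ε₀ B₃ B₃' a₁ : ℝ),
        RunConstRemainder (betaOfRecord₁₃ F 2 (theta13OfThm1CCM F 2 j ε₀ ε₂₉ B₃ B₃' a₀ a₁)) (fun _ => 0) β' γ₀) :
    Summit.QuantumFields.YangMills.Theses.BalabanUVNodes.Record13SepCoPHInhabited :=
  record13SepCoPHInhabited_of_stub1_run3R_byName h1 fun F => (run3R_iff_uniform F).mpr (hU F)

/-- **K0⁷ BY NAME FROM STUB 1's TEXT AND THE TOKEN-FREE RUN CORE.**  CONDITIONAL; K0⁷ OPEN.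
[cite: Balaban1985Variational, Thm 1 p.279, Prop. 8 p.304; Balaban1988Convergent, Thm 1 p.262; Balaban1987RG1, Thm 1 p.259, Thm 3 p.264; Balaban1989LargeFieldII, p.355] -/
theorem record13SepCoPHInhabited_of_stub1_tokenFreeRunCore_byName (h1 : ∀ F : T4Family, Prop8StepCoPAt F)
    (hT : ∀ (F : T4Family) (a₀ : ℝ), 0 < a₀ → ∃ γ₀ ε₂₉ β' : ℝ, 0 < γ₀ ∧ 0 < ε₂₉ ∧ ∀ (j : ℕ) (ε₀ B₃ B₃' a₁ : ℝ),
      RunConstRemainder (betaOfRecord₁₃ F 2 (theta13OfThm1CCM F 2 j ε₀ ε₂₉ B₃ B₃' a₀ a₁)) (fun _ => 0) β' γ₀) :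
    Summit.QuantumFields.YangMills.Theses.BalabanUVNodes.Record13SepCoPHInhabited :=
  record13SepCoPHInhabited_of_stub1_run3R_byName h1 fun F => run3R_of_tokenFree F (hT F)

/-- **K0⁷ BY NAME FROM STUB 1's TEXT AND A RUN LETTER AT THE C¹ WITNESS PER ADMISSIBLE `a₀`.**  CONDITIONAL; K0⁷ OPEN.
[cite: Balaban1985Variational, Thm 1 p.279, Prop. 8 p.304; Balaban1988Convergent, Thm 1 p.262; Balaban1987RG1, Thm 1 p.259, Thm 3 p.264; Balaban1989LargeFieldII, p.355] -/
theorem record13SepCoPHInhabited_of_stub1_runAtCC1_byName (h1 : ∀ F : T4Family, Prop8StepCoPAt F)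
    (hC : ∀ (F : T4Family) (a₀ : ℝ), 0 < a₀ →
      (∃ (j c : ℕ) (B₃ B₃' a₁ : ℝ), c ≤ F.L ^ j ∧ 2 * (F.L : ℝ) ^ 2 ≤ B₃ ∧ 0 < B₃' ∧ 0 < a₁ ∧
        VariationalThm1RegSepCoP7M F 2 B₃ a₀ a₁ ∧
        Gauge9RegSepTopStepR F 2 (fun ν K Ω => suppDomOfRecord F ν K Ω) (F.L ^ j) c B₃ B₃' a₀ a₁) →
      ∃ (ε₀ B₃ B₃' a₁ γ₀ ε₂₉ β' : ℝ), 0 < γ₀ ∧ 0 < ε₂₉ ∧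
        RunConstRemainder (betaOfRecord₁₃ F 2 (theta13OfThm1CC1 F 2 ε₀ ε₂₉ B₃ B₃' a₀ a₁)) (fun _ => 0) β' γ₀) :
    Summit.QuantumFields.YangMills.Theses.BalabanUVNodes.Record13SepCoPHInhabited :=
  record13SepCoPHInhabited_of_stub1_run3R_byName h1 fun F => run3R_of_runAtCC1 F (hC F)

end Stubs

end Summit.QuantumFields.YangMills.Theorems.K0Stub3CubeLetterBlind

end
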